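/-
Copyright (c) 2026 the pub-hodgecm-mathlib formalisation cell (harness21).  Prover seat hodgecm-mathlib-F0P3a-p02 (g22): N8 ROAD CENSUS v0 (fd90e2d340c810dd) CUT B —
the `hα`-twins of the letter-L1 frame-form closers (MIXED ∕ central corners) for the QUASI-SPLIT frame of `G_∞ = U(Φ₃)_∞`.  THEOREMS ONLY.
-/
import Literature.NumberTheory.Rogawski1990.ArchOrbFamGExtCentralMixedJetBounds   -- ★ p851488∕p851493 (F0P3a-p08 (g23)): the ORIGINALS twinned here + their whole import cone (★ p851409 `mixedJetBounds_of_normalised (hα)`)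
import HarnessLib

/-!
# (I₁) at the central ∕ mixed corners for a NON-DEGENERATE diagonal frame — the `hα`-twins of ★ `ArchOrbFamGExtCentralMixedJetBounds` (N8 census CUT B); file name mirrors the ★ original + `Nondeg` (LH10-p02 (g8) naming token 14:10Z)

Topic `NumberTheory/Rogawski1990`; namespace `Literature.NumberTheory.Rogawski1990`.  THEOREMS ONLY (no `def`, no instance, no notation, no axiom, no named fact, no `sorry`).
Cell `pub/hodgecm-mathlib`, crux H413 (`stmt-HodgeConjecture-24833`); N8 ROAD CENSUS v0 `F0/P3a/F0P3a-p02/g22/N8-ROAD-CENSUS.v0.F0P3ap02g22.md` §4 CUT B ∕ §5 (1) (LEAD T13-39: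
price tag; LH10-p02 (g8) 14:06Z default + this seat's co-hand split: CROSS + MIXED here, JUMP∕FACES∕CENTRAL(scalar)∕HEAD by LH10-p02).  Count-neutral.

WHY: see ★-twin `ArchOrbFamGExtCrossCornerNondeg` — the L1 closers read `hanis` ONLY through ★ `ne_zero_of_diagonal_anisotropic`; bodies VERBATIM with the binder swapped.
* `exists_nhds_bddAbove_norm_iteratedFDeriv_orbFamGExt_of_mixedCorner_normalised_of_desc_of_ne_zero` — O-L1d′-N over the one-place parametric descent, `hα` frame;
* `exists_nhds_bddAbove_norm_iteratedFDeriv_orbFamGExt_of_mixedCorner_normalised_of_ne_zero` — O-L1d′-N hypothesis-free, `hα` frame;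
* `centralMixedJetBounds_of_normalised_of_ne_zero` — twin of ★ `centralMixedJetBounds_of_normalised` (the `hCm` socket from its normalised form) in the `(hherm, hα)` frame.

HONEST LABEL: HC_CM is proved only modulo the 7 printed citations (hLiu418 = `stmt-HodgeConjecture-24832`, h413 = `stmt-HodgeConjecture-24833`) until rung 0 closes; re-derivation under a weaker frame, pays no organ, opens no road.

## References
* [Shelstad1979] D. Shelstad, *Characters and inner forms of a quasi-split group over ℝ*, Compositio Math. 39 (1979), §4 (II) p. 23; Lemma 4.3 p. 25. [Bouaziz1994IntegralesOrbitales] A. Bouaziz, Ann. Sci. ÉNS 27 (1994), §3.1–3.2 pp. 579–580. [Varadarajan1977] V. S. Varadarajan, LNM 576 (1977), I §1.12. [Rogawski1990] J. D. Rogawski, Ann. of Math. Stud. 123 (1990), §8.2 pp. 118–124.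
-/

set_option autoImplicit false

noncomputable section

open MeasureTheory MeasureTheory.Measure Set Filter Topology Function Metric NumberField NumberField.InfinitePlace
open Literature.NumberTheory.Automorphic Literature.NumberTheory.Automorphic.UnitaryGroup Literature.NumberTheory.Automorphic.ArchCartan Literature.Analysis.Calculus
open Literature.Geometry.ComplexHyperbolic.BallModel Literature.MeasureTheory.Constructions
open scoped MatrixGroups Matrix.Norms.Operator ContDiff ENNReal Classical

namespace Literature.NumberTheory.Rogawski1990

section MixedNondeg

variable (L : Type) [Field L] [NumberField L] [IsCMField L] (α : Fin 3 → L)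
  [MeasurableSpace ↥(arch (↥(maximalRealSubfield L)) L (IsCMField.complexConj L) 3 (Matrix.diagonal α))]
  [BorelSpace ↥(arch (↥(maximalRealSubfield L)) L (IsCMField.complexConj L) 3 (Matrix.diagonal α))]
  (ν' : Measure ↥(arch (↥(maximalRealSubfield L)) L (IsCMField.complexConj L) 3 (Matrix.diagonal α))) [ν'.IsHaarMeasure] [ν'.IsMulRightInvariant]

/-- **`hα`-TWIN (N8 census CUT B) of ★ `exists_nhds_bddAbove_norm_iteratedFDeriv_orbFamGExt_of_mixedCorner_normalised_of_desc`** — binder `hanis` ↦ `hα : ∀ i, α i ≠ 0`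
(its only use was ★ `ne_zero_of_diagonal_anisotropic`), statement and body otherwise VERBATIM (docstring of the original applies word for word); valid on the isotropic quasi-split
frame `diag(½,1,−½) ≃ Φ₃`. [cite: Varadarajan1977, Part I §1.12] [cite: Bouaziz1994IntegralesOrbitales, §3.1 (I₁)–(I₂) p. 579; §3.2 p. 580] [cite: Shelstad1979, §4 pp. 22–25] [cite: Rogawski1990, §8.2 pp. 118–124] [cite: WarnerHASSLG2, Thm. 8.4.3.1] [cite: HormanderALPDO1, §1.1 Thms. 1.1.8, 1.1.9] -/
theorem exists_nhds_bddAbove_norm_iteratedFDeriv_orbFamGExt_of_mixedCorner_normalised_of_desc_of_ne_zero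
    (hherm : ((Matrix.diagonal α).map (cmConjRingHom L)).transpose = Matrix.diagonal α)
    (hα : ∀ i, α i ≠ 0)
    (a' : ↥(arch (↥(maximalRealSubfield L)) L (IsCMField.complexConj L) 3 (Matrix.diagonal α)) → ℂ) (ha' : ArchSmooth L 3 (Matrix.diagonal α) a')
    (hdesc : ∀ {J : Matrix (Fin 2) (Fin 2) ℂ} (hJ : J = (StdForm.antidiagonal 2).over ℂ)
      [MeasurableSpace ↥(unitaryGroupOfForm (starRingEnd ℂ) J)] [BorelSpace ↥(unitaryGroupOfForm (starRingEnd ℂ) J)]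
      [LocallyCompactSpace ↥(unitaryGroupOfForm (starRingEnd ℂ) J)] [SecondCountableTopology ↥(unitaryGroupOfForm (starRingEnd ℂ) J)]
      (μ₀ : Measure ↥(unitaryGroupOfForm (starRingEnd ℂ) J)) [μ₀.IsHaarMeasure] [μ₀.IsMulRightInvariant]
      (S' : Finset {w : InfinitePlace L // IsComplex w}), (∀ w, w ∈ S' → w ∈ splitChartPlaces L α) →
      ∀ (w : {w : InfinitePlace L // IsComplex w}), w ∉ S' → w ∈ splitChartPlaces L α →
      ∀ (pw : Fin 3 → ℝ), pw 0 = pw 2 → Circle.exp (pw 0) ≠ Circle.exp (pw 1) →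
      ∀ [MeasurableSpace ↥(archLocal L 3 (Matrix.diagonal α) w)] [BorelSpace ↥(archLocal L 3 (Matrix.diagonal α) w)]
        (νw : Measure ↥(archLocal L 3 (Matrix.diagonal α) w)) [νw.IsHaarMeasure] [νw.IsMulRightInvariant],
      ∀ (P : Type) [NormedAddCommGroup P] [NormedSpace ℝ P] [FiniteDimensional ℝ P] (Θ : P × Matrix (Fin 3) (Fin 3) ℂ → ℂ),
        ContDiff ℝ ∞ Θ → ∀ C : Set (Matrix (Fin 3) (Fin 3) ℂ), IsCompact C → (∀ (π : P) (X : Matrix (Fin 3) (Fin 3) ℂ), X ∉ C → Θ (π, X) = 0) →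
        ∃ (K : ℝ) (U : Set (Fin 3 → ℝ)) (f : (P × (Fin 3 → ℝ)) × Matrix (Fin 2) (Fin 2) ℂ → ℂ) (C' : Set (Matrix (Fin 2) (Fin 2) ℂ)),
          K ≠ 0 ∧ IsOpen U ∧ pw ∈ U ∧ ContDiff ℝ ∞ f ∧ IsCompact C' ∧ (∀ (q : P × (Fin 3 → ℝ)) (X : Matrix (Fin 2) (Fin 2) ℂ), X ∉ C' → f (q, X) = 0) ∧
          (∀ π : P, (∀ X, Θ (π, X) = 0) → ∀ (cw : Fin 3 → ℝ) (X : Matrix (Fin 2) (Fin 2) ℂ), f ((π, cw), X) = 0) ∧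
          ∀ (π : P) (cw : Fin 3 → ℝ), cw ∈ U → Injective (fun i : Fin 3 => Circle.exp (cw i)) →
            ∫ g : ↥(archLocal L 3 (Matrix.diagonal α) w),
                Θ (π, (((g * gprimeBlockAt L α w S' cw * g⁻¹ : ↥(archLocal L 3 (Matrix.diagonal α) w)) : GL (Fin 3) ℂ) : Matrix (Fin 3) (Fin 3) ℂ)) ∂νw =
              K • ∫ h : ↥(unitaryGroupOfForm (starRingEnd ℂ) J),
                f ((π, cw), (((h * ⟨Matrix.GeneralLinearGroup.mkOfDetNeZero !![(1 : ℂ), 1; 1, -1] det_cayleyTwo_ne_zero *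
                    circleDiagonal 2 ![Circle.exp ((cw 0 - cw 2) / 2), Circle.exp (-((cw 0 - cw 2) / 2))] *
                    (Matrix.GeneralLinearGroup.mkOfDetNeZero !![(1 : ℂ), 1; 1, -1] det_cayleyTwo_ne_zero)⁻¹, cayley_conj_circleDiagonal_mem_of_eq_over hJ _⟩ * h⁻¹ :
                  ↥(unitaryGroupOfForm (starRingEnd ℂ) J)) : GL (Fin 2) ℂ) : Matrix (Fin 2) (Fin 2) ℂ)) ∂μ₀) :
    ∀ (S' : Finset {w : InfinitePlace L // IsComplex w}), (∀ w, w ∈ S' → w ∈ splitChartPlaces L α) →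
      ∀ (n : ℕ) (x : {w : InfinitePlace L // IsComplex w} → Fin 3 → ℝ),
      (∀ w' : {w : InfinitePlace L // IsComplex w}, w' ∉ S' → ∀ l : Fin 3, x w' l ∈ Ico 0 (2 * Real.pi)) →
      (∃ w : {w : InfinitePlace L // IsComplex w}, w ∉ S' ∧ (∃ i j : Fin 3, i ≠ j ∧ slotSign L α w i ≠ slotSign L α w j) ∧
        (∀ l l' : Fin 3, Circle.exp (x w l) = Circle.exp (x w l')) ∧
        ∃ w', w' ∉ S' ∧ w' ≠ w ∧ ∃ i' j' : Fin 3, i' ≠ j' ∧ slotSign L α w' i' ≠ slotSign L α w' j' ∧ Circle.exp (x w' i') = Circle.exp (x w' j')) →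
      (∀ w' : {w : InfinitePlace L // IsComplex w}, w' ∉ S' → slotSign L α w' 1 ≠ slotSign L α w' 2 →
        Circle.exp (x w' 1) = Circle.exp (x w' 2) → Circle.exp (x w' 0) = Circle.exp (x w' 1)) →
      ∃ U ∈ 𝓝 x, BddAbove ((fun c => ‖iteratedFDeriv ℝ n (orbFamGExt L α ν' a' S') c‖) '' (U ∩ InRegG (slotSign L α) S')) := by
  intro S' hS' n x hcube hmix hnorm
  -- the frame
  have hreal : ∀ (w' : {w : InfinitePlace L // IsComplex w}) (i : Fin 3), (w'.1.embedding (α i)).im = 0 :=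
    im_embedding_diagonal_eq_zero L 3 α (complexConj_apply_eq_of_diagonal_frame hherm)
  -- the rank-one Cayley carrier `U(J)` with a two-sided Haar measure, and the Borel structures on the local groups
  obtain ⟨J, hJ⟩ : ∃ J : Matrix (Fin 2) (Fin 2) ℂ, J = (StdForm.antidiagonal 2).over ℂ := ⟨_, rfl⟩
  letI : MeasurableSpace ↥(unitaryGroupOfForm (starRingEnd ℂ) J) := borel _
  haveI : BorelSpace ↥(unitaryGroupOfForm (starRingEnd ℂ) J) := ⟨rfl⟩
  haveI : LocallyCompactSpace ↥(unitaryGroupOfForm (starRingEnd ℂ) J) := locallyCompactSpace_unitaryGroupOfForm_complex J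
  haveI : SecondCountableTopology ↥(unitaryGroupOfForm (starRingEnd ℂ) J) := secondCountableTopology_unitaryGroupOfForm_complex J
  letI : MeasurableSpace (↥(unitaryGroupOfForm (starRingEnd ℂ) J) ⧸ torusU (starRingEnd ℂ) J) := borel _
  haveI : BorelSpace (↥(unitaryGroupOfForm (starRingEnd ℂ) J) ⧸ torusU (starRingEnd ℂ) J) := ⟨rfl⟩
  obtain ⟨μ₀, hμ₀H, hμ₀R, -⟩ := sharedRankOneDatum_exists hJ
  haveI := hμ₀H
  haveI := hμ₀R
  letI : ∀ w : {w : InfinitePlace L // IsComplex w}, MeasurableSpace ↥(archLocal L 3 (Matrix.diagonal α) w) := fun w => borel _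
  haveI : ∀ w : {w : InfinitePlace L // IsComplex w}, BorelSpace ↥(archLocal L 3 (Matrix.diagonal α) w) := fun w => ⟨rfl⟩
  -- STEP 1: the nc-singular places `p`, scalar places, faces; enumeration
  obtain ⟨w₀, hw₀S, -, hsc₀, -⟩ := hmix
  obtain ⟨p, hpdef⟩ : ∃ p : {w : InfinitePlace L // IsComplex w} → Prop,
      p = fun w => w ∉ S' ∧ ∃ i j : Fin 3, i ≠ j ∧ slotSign L α w i ≠ slotSign L α w j ∧ Circle.exp (x w i) = Circle.exp (x w j) := ⟨_, rfl⟩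
  have hpiff : ∀ w, p w ↔ (w ∉ S' ∧ ∃ i j : Fin 3, i ≠ j ∧ slotSign L α w i ≠ slotSign L α w j ∧ Circle.exp (x w i) = Circle.exp (x w j)) :=
    fun w => by rw [hpdef]
  obtain ⟨m₁, m₂, e₂ℕ, e₁, h₂p, h₁p, hbij, h₂sc, h₁nsc, h₂inj, h₁inj, hdisj⟩ :=
    exists_enumeration_sum_elim_bijective p (fun w : {w : InfinitePlace L // IsComplex w} => ∀ l l' : Fin 3, Circle.exp (x w l) = Circle.exp (x w l')) w₀
  set eσ := Equiv.ofBijective _ hbij with heσ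
  have hp : ∀ w : {w : InfinitePlace L // IsComplex w}, p w → w ∉ S' := fun w hw => ((hpiff w).1 hw).1
  have hxin : ∀ w : {w : InfinitePlace L // IsComplex w}, w ∉ S' → ¬ p w →
      ∀ i j : Fin 3, i ≠ j → slotSign L α w i ≠ slotSign L α w j → Circle.exp (x w i) ≠ Circle.exp (x w j) :=
    fun w hw hnp i j hij hs hc => hnp ((hpiff w).2 ⟨hw, i, j, hij, hs, hc⟩)
  -- face data and scalar data
  have hface : ∀ j : Fin m₁, x (e₁ j) 0 = x (e₁ j) 2 ∧ Circle.exp (x (e₁ j) 0) ≠ Circle.exp (x (e₁ j) 1) ∧ e₁ j ∈ splitChartPlaces L α :=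
    fun j => faceData_of_normalised L α hα hcube hnorm ((hpiff _).1 (h₁p j)).1 (hreal _) ((hpiff _).1 (h₁p j)).2 (h₁nsc j)
  have he₁S : ∀ j : Fin m₁, e₁ j ∉ S' := fun j => ((hpiff _).1 (h₁p j)).1
  have he₂S : ∀ k : Fin m₂, e₂ℕ k.val ∉ S' := fun k => ((hpiff _).1 (h₂p k)).1
  have hxsc : ∀ (k : Fin m₂) (l l' : Fin 3), x (e₂ℕ k.val) l = x (e₂ℕ k.val) l' :=
    fun k => scalar_literal_of_cube L hcube (he₂S k) (h₂sc k)
  -- STEP 2: PKG-T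
  obtain ⟨νl, hνlH, hνlR, U₀, u₀, Θ, C, hU₀o, hxU₀, hu₀, hΘ, hC, hΘC, hfacT⟩ :=
    exists_partialUnfoldedModel_pi_isolate L α ν' hα hreal hS' ha' p hp hxin
  haveI : ∀ w : {w : InfinitePlace L // IsComplex w}, (νl w).IsHaarMeasure := hνlH
  haveI : ∀ w : {w : InfinitePlace L // IsComplex w}, (νl w).IsMulRightInvariant := hνlR
  haveI : ∀ w : {w : InfinitePlace L // IsComplex w}, LocallyCompactSpace (archLocal L 3 (Matrix.diagonal α) w) := fun w => locallyCompactSpace_archLocal L 3 (Matrix.diagonal α) w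
  haveI : ∀ w : {w : InfinitePlace L // IsComplex w}, SecondCountableTopology (archLocal L 3 (Matrix.diagonal α) w) := fun w => secondCountableTopology_archLocal L 3 (Matrix.diagonal α) w
  -- STEP 3: the coordinate cut-off making the partial model global
  obtain ⟨χ, hχd, -, hχU, hχ1⟩ := exists_contDiff_tsupport_subset_eventually_eq_one (hU₀o.mem_nhds hxU₀)
  obtain ⟨O₁, hO₁1, hO₁o, hxO₁⟩ := _root_.mem_nhds_iff.1 hχ1
  obtain ⟨Θχ, hΘχdef⟩ : ∃ Θχ : ({w : InfinitePlace L // IsComplex w} → Fin 3 → ℝ) ×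
      ({w : {w : InfinitePlace L // IsComplex w} // p w} →
        Matrix (Fin 3) (Fin 3) ℂ) → ℂ, Θχ = fun q => (χ q.1 : ℝ) • Θ q := ⟨_, rfl⟩
  have hΘχd : ContDiff ℝ ∞ Θχ := by
    rw [hΘχdef, contDiff_iff_contDiffAt]
    intro q
    by_cases hq : q.1 ∈ U₀
    · have hnhds : U₀ ×ˢ (univ : Set ({w : {w : InfinitePlace L // IsComplex w} // p w} → Matrix (Fin 3) (Fin 3) ℂ)) ∈ 𝓝 q := by
        rw [← Prod.mk.eta (p := q)]; exact prod_mem_nhds (hU₀o.mem_nhds hq) univ_mem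
      exact ((hχd.comp contDiff_fst).contDiffAt).smul (hΘ.contDiffAt hnhds)
    · have hq' : q.1 ∉ tsupport χ := fun h => hq (hχU h)
      have hev : χ =ᶠ[𝓝 q.1] 0 := notMem_tsupport_iff_eventuallyEq.1 hq'
      have hev2 : (fun q' : ({w : InfinitePlace L // IsComplex w} → Fin 3 → ℝ) ×
          ({w : {w : InfinitePlace L // IsComplex w} // p w} →
            Matrix (Fin 3) (Fin 3) ℂ) => (χ q'.1 : ℝ) • Θ q') =ᶠ[𝓝 q] fun _ => 0 :=
        (continuous_fst.continuousAt.eventually hev).mono fun q' hq' => by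
          show (χ q'.1 : ℝ) • Θ q' = 0
          rw [show χ q'.1 = 0 from hq', zero_smul]
      exact contDiffAt_const.congr_of_eventuallyEq hev2
  have hΘχC : ∀ c Y, (∃ w, Y w ∉ C) → Θχ (c, Y) = 0 := fun c Y hY => by
    rw [hΘχdef]; show (χ c : ℝ) • Θ (c, Y) = 0; rw [hΘC c Y hY, smul_zero]
  have hΘχ1 : ∀ c ∈ O₁, ∀ Y, Θχ (c, Y) = Θ (c, Y) := fun c hc Y => by
    rw [hΘχdef]; show (χ c : ℝ) • Θ (c, Y) = Θ (c, Y); rw [show χ c = 1 from hO₁1 hc, one_smul]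
  -- STEP 4: the face tower INSIDE the `Z`-integral: glue, the face family `ΘF`, the descent
  obtain ⟨ΘF, hΘFdef⟩ : ∃ ΘF : (({w : InfinitePlace L // IsComplex w} → Fin 3 → ℝ) × (Fin m₂ → Matrix (Fin 3) (Fin 3) ℂ)) × (Fin m₁ → Matrix (Fin 3) (Fin 3) ℂ) → ℂ,
      ΘF = fun q => Θχ (q.1.1, fun i => Sum.elim q.1.2 q.2 (eσ.symm i)) := ⟨_, rfl⟩
  have hglue : ContDiff ℝ ∞ fun q : (({w : InfinitePlace L // IsComplex w} → Fin 3 → ℝ) × (Fin m₂ → Matrix (Fin 3) (Fin 3) ℂ)) × (Fin m₁ → Matrix (Fin 3) (Fin 3) ℂ) =>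
      fun i => Sum.elim q.1.2 q.2 (eσ.symm i) := by
    refine contDiff_pi.2 fun i => ?_
    rcases hs : eσ.symm i with k | j
    · simp only [Sum.elim_inl]
      exact (contDiff_apply ℝ (Matrix (Fin 3) (Fin 3) ℂ) k).comp (contDiff_snd.comp contDiff_fst)
    · simp only [Sum.elim_inr]
      exact (contDiff_apply ℝ (Matrix (Fin 3) (Fin 3) ℂ) j).comp contDiff_snd
  have hΘFd : ContDiff ℝ ∞ ΘF := by
    rw [hΘFdef]; exact hΘχd.comp ((contDiff_fst.comp contDiff_fst).prodMk hglue)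
  have hΘFC : ∀ (π : ({w : InfinitePlace L // IsComplex w} → Fin 3 → ℝ) × (Fin m₂ → Matrix (Fin 3) (Fin 3) ℂ)) (X₁ : Fin m₁ → Matrix (Fin 3) (Fin 3) ℂ),
      (∃ j, X₁ j ∉ C) → ΘF (π, X₁) = 0 := by
    rintro π X₁ ⟨j, hj⟩
    rw [hΘFdef]
    refine hΘχC _ _ ⟨eσ (Sum.inr j), ?_⟩
    rw [Equiv.symm_apply_apply, Sum.elim_inr]
    exact hj
  have hΘFC₂ : ∀ (c : {w : InfinitePlace L // IsComplex w} → Fin 3 → ℝ) (X₂ : Fin m₂ → Matrix (Fin 3) (Fin 3) ℂ) (X₁ : Fin m₁ → Matrix (Fin 3) (Fin 3) ℂ),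
      (∃ k, X₂ k ∉ C) → ΘF ((c, X₂), X₁) = 0 := by
    rintro c X₂ X₁ ⟨k, hk⟩
    rw [hΘFdef]
    refine hΘχC _ _ ⟨eσ (Sum.inl k), ?_⟩
    rw [Equiv.symm_apply_apply, Sum.elim_inl]
    exact hk
  obtain ⟨K, UF, fF, C', hK, hUFo, hxUF, hfF, hC', hfFC, hfFZ, hfFI⟩ :=
    exists_faceDescentTower L α S' νl hJ μ₀ hα m₁ e₁ (fun j => x (e₁ j)) (fun j => he₁S j)
      (fun j => hdesc hJ μ₀ S' hS' (e₁ j) (he₁S j) (hface j).2.2 (x (e₁ j)) (hface j).1 (hface j).2.1 (νl (e₁ j)))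
      ((({w : InfinitePlace L // IsComplex w} → Fin 3 → ℝ) × (Fin m₂ → Matrix (Fin 3) (Fin 3) ℂ))) ΘF hΘFd C hC hΘFC
  -- STEP 5: the charts `Φ₁` (faces), `Φ₂` (relabelled scalar angles), the dress `v`, the tower base `fT`, the neighbourhood `U'`
  obtain ⟨Φ₁, hΦ₁⟩ : ∃ Φ₁ : ({w : InfinitePlace L // IsComplex w} → Fin 3 → ℝ) →L[ℝ] (Fin m₁ → ℝ), ∀ c j, Φ₁ c j = (c (e₁ j) 0 - c (e₁ j) 2) / 2 :=
    ⟨ContinuousLinearMap.pi fun j : Fin m₁ => (1 / 2 : ℝ) •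
      ((ContinuousLinearMap.proj (R := ℝ) (φ := fun _ : Fin 3 => ℝ) 0).comp
          (ContinuousLinearMap.proj (R := ℝ) (φ := fun _ : {w : InfinitePlace L // IsComplex w} => Fin 3 → ℝ) (e₁ j)) -
        (ContinuousLinearMap.proj (R := ℝ) (φ := fun _ : Fin 3 => ℝ) 2).comp
          (ContinuousLinearMap.proj (R := ℝ) (φ := fun _ : {w : InfinitePlace L // IsComplex w} => Fin 3 → ℝ) (e₁ j))),
      fun c j => by
        simp only [ContinuousLinearMap.pi_apply, FunLike.coe_smul, FunLike.coe_sub, Pi.smul_apply, Pi.sub_apply,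
          ContinuousLinearMap.coe_comp, Function.comp_apply, ContinuousLinearMap.proj_apply, smul_eq_mul]
        ring⟩
  obtain ⟨Φ₂, hΦ₂⟩ : ∃ Φ₂ : ({w : InfinitePlace L // IsComplex w} → Fin 3 → ℝ) →L[ℝ] (Fin m₂ → Fin 3 → ℝ),
      ∀ c k l, Φ₂ c k l = c (e₂ℕ k.val) ((lineOf (formSign L α (e₂ℕ k.val))).symm l) :=
    ⟨ContinuousLinearMap.pi fun k : Fin m₂ => ContinuousLinearMap.pi fun l : Fin 3 =>
      (ContinuousLinearMap.proj (R := ℝ) (φ := fun _ : Fin 3 => ℝ) ((lineOf (formSign L α (e₂ℕ k.val))).symm l)).comp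
        (ContinuousLinearMap.proj (R := ℝ) (φ := fun _ : {w : InfinitePlace L // IsComplex w} => Fin 3 → ℝ) (e₂ℕ k.val)),
      fun c k l => rfl⟩
  obtain ⟨v, hv, hvfac⟩ := exists_contDiff_cptTrig_eq_mul_prod_sin_mul_prod_rootProduct S' x e₁ (fun k : Fin m₂ => e₂ℕ k.val) h₁inj
    (fun k k' h => h₂inj k k' h) (fun j k => hdisj j k) he₁S he₂S (fun k => lineOf (formSign L α (e₂ℕ k.val))) hxsc
  obtain ⟨fT, hfTdef⟩ : ∃ fT : ({w : InfinitePlace L // IsComplex w} → Fin 3 → ℝ) × ((Fin m₁ → Matrix (Fin 2) (Fin 2) ℂ) × (Fin m₂ → Matrix (Fin 3) (Fin 3) ℂ)) → ℂ,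
      fT = fun q => fF (((q.1, q.2.2), fun j => q.1 (e₁ j)), q.2.1) := ⟨_, rfl⟩
  obtain ⟨A, hAdef⟩ : ∃ A : ({w : InfinitePlace L // IsComplex w} → Fin 3 → ℝ) →L[ℝ] ({w : InfinitePlace L // IsComplex w} → Fin 3 → ℝ),
      A = ContinuousLinearMap.id ℝ _ := ⟨_, rfl⟩
  have hA : ∀ c, A c = c := fun c => by rw [hAdef]; rfl
  obtain ⟨ζ, hζdef⟩ : ∃ ζ : {w : InfinitePlace L // IsComplex w} → Circle, ζ = fun w => Circle.exp (x w 0) := ⟨_, rfl⟩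
  have hζ : ∀ w, ζ w = Circle.exp (x w 0) := fun w => by rw [hζdef]
  obtain ⟨uu, huudef⟩ : ∃ uu : ({w : InfinitePlace L // IsComplex w} → Fin 3 → ℝ) → ℂ, uu = fun c => v c * u₀ c * (K : ℂ) := ⟨_, rfl⟩
  set U' : Set ({w : InfinitePlace L // IsComplex w} → Fin 3 → ℝ) := O₁ ∩ U₀ ∩ (fun c => fun j => c (e₁ j)) ⁻¹' UF with hU'
  have hcwFc : Continuous fun c : {w : InfinitePlace L // IsComplex w} → Fin 3 → ℝ => fun j => c (e₁ j) := continuous_pi fun j => continuous_apply (e₁ j)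
  have hU'n : U' ∈ 𝓝 x := inter_mem (inter_mem (hO₁o.mem_nhds hxO₁) (hU₀o.mem_nhds hxU₀)) (hcwFc.continuousAt.preimage_mem_nhds (hUFo.mem_nhds hxUF))
  -- STEP 6: THE MODEL IDENTITY on `U' ∩ RegG S'`
  have hmodel : ∀ c ∈ U' ∩ RegG S', orbFamGExt L α ν' a' S' c =
      uu c * ((∏ k : Fin m₂, rootProduct ((Φ₂ c - Φ₂ x) k)) • ∫ g : ((k : Fin m₂) → ↥(archLocal L 3 (Matrix.diagonal α) (e₂ℕ k.val))),
          (fun z' : (({w : InfinitePlace L // IsComplex w} → Fin 3 → ℝ) × (Fin m₁ → ℝ)) × (Fin m₂ → Matrix (Fin 3) (Fin 3) ℂ) =>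
        ((∏ k : Fin m₁, 2 * Real.sin (z'.1.2 k)) • ∫ h : Fin m₁ → ↥(unitaryGroupOfForm (starRingEnd ℂ) J),
          (fun y : (({w : InfinitePlace L // IsComplex w} → Fin 3 → ℝ) × (Fin m₂ → Matrix (Fin 3) (Fin 3) ℂ)) × (Fin m₁ → Matrix (Fin 2) (Fin 2) ℂ) => fT (y.1.1, (y.2, y.1.2)))
            ((z'.1.1, z'.2), fun k => (((h k * ⟨Matrix.GeneralLinearGroup.mkOfDetNeZero !![(1 : ℂ), 1; 1, -1] det_cayleyTwo_ne_zero * circleDiagonal 2 ![Circle.exp (z'.1.2 k), Circle.exp (-(z'.1.2 k))] * (Matrix.GeneralLinearGroup.mkOfDetNeZero !![(1 : ℂ), 1; 1, -1] det_cayleyTwo_ne_zero)⁻¹, cayley_conj_circleDiagonal_mem_of_eq_over hJ _⟩ * (h k)⁻¹ : ↥(unitaryGroupOfForm (starRingEnd ℂ) J)) : GL (Fin 2) ℂ) : Matrix (Fin 2) (Fin 2) ℂ)) ∂(Measure.pi fun _ : Fin m₁ => μ₀)))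
            ((A c, Φ₁ c), fun k => (((g k * (⟨circleDiagonal 3 (fun i => ζ (e₂ℕ k.val) * Circle.exp ((Φ₂ c - Φ₂ x) k i)), circleDiagonal_mem_archLocal_diagonal L 3 α (e₂ℕ k.val) _⟩ : ↥(archLocal L 3 (Matrix.diagonal α) (e₂ℕ k.val))) * (g k)⁻¹ : ↥(archLocal L 3 (Matrix.diagonal α) (e₂ℕ k.val))) : GL (Fin 3) ℂ) : Matrix (Fin 3) (Fin 3) ℂ))
            ∂(Measure.pi fun k : Fin m₂ => νl (e₂ℕ k.val))) := by
    rintro c ⟨⟨⟨hcO₁, hcU₀⟩, hcUF⟩, hcreg⟩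
    rw [hA c, huudef]
    simp only [hζ]
    have hregF : ∀ j : Fin m₁, Injective fun i : Fin 3 => Circle.exp (c (e₁ j) i) := fun j => hcreg.1 _ (he₁S j)
    -- (6a) integrability on `Π_p G_w` at the regular point `c`
    have hΘeq : ∀ Y, Θ (c, Y) = Θχ (c, Y) := fun Y => (hΘχ1 c hcO₁ Y).symm
    have hint : Integrable (fun g : (∀ w : {w : {w : InfinitePlace L // IsComplex w} // p w}, ↥(archLocal L 3 (Matrix.diagonal α) w.1)) => Θ (c, fun w => (((g w * gprimeBlockAt L α w.1 S' (c w.1) * (g w)⁻¹ : ↥(archLocal L 3 (Matrix.diagonal α) w.1)) : GL (Fin 3) ℂ) : Matrix (Fin 3) (Fin 3) ℂ)))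
        (Measure.pi fun w : {w : {w : InfinitePlace L // IsComplex w} // p w} => νl w.1) := by
      have hΘc : Continuous fun Y : {w : {w : InfinitePlace L // IsComplex w} // p w} → Matrix (Fin 3) (Fin 3) ℂ => Θχ (c, Y) :=
        hΘχd.continuous.comp (continuous_const.prodMk continuous_id)
      have hA : Continuous fun g : (∀ w : {w : {w : InfinitePlace L // IsComplex w} // p w}, ↥(archLocal L 3 (Matrix.diagonal α) w.1)) => fun w => (((g w * gprimeBlockAt L α w.1 S' (c w.1) * (g w)⁻¹ : ↥(archLocal L 3 (Matrix.diagonal α) w.1)) : GL (Fin 3) ℂ) : Matrix (Fin 3) (Fin 3) ℂ) :=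
        continuous_pi fun w => (Units.continuous_val.comp continuous_subtype_val).comp ((((continuous_apply w).mul continuous_const)).mul (continuous_apply w).inv)
      have hS : ∀ w : {w : {w : InfinitePlace L // IsComplex w} // p w}, IsCompact {g : ↥(archLocal L 3 (Matrix.diagonal α) w.1) | (((g * gprimeBlockAt L α w.1 S' (c w.1) * (g)⁻¹ : ↥(archLocal L 3 (Matrix.diagonal α) w.1)) : GL (Fin 3) ℂ) : Matrix (Fin 3) (Fin 3) ℂ) ∈ C} :=
        fun w => isCompact_setOf_conj_gprimeBlockAt_mem L α S' hα (hp _ w.2) (hcreg.1 _ (hp _ w.2)) hC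
      have hintχ : Integrable (fun g : (∀ w : {w : {w : InfinitePlace L // IsComplex w} // p w}, ↥(archLocal L 3 (Matrix.diagonal α) w.1)) => Θχ (c, fun w => (((g w * gprimeBlockAt L α w.1 S' (c w.1) * (g w)⁻¹ : ↥(archLocal L 3 (Matrix.diagonal α) w.1)) : GL (Fin 3) ℂ) : Matrix (Fin 3) (Fin 3) ℂ)))
          (Measure.pi fun w : {w : {w : InfinitePlace L // IsComplex w} // p w} => νl w.1) := by
        refine (hΘc.comp hA).integrable_of_hasCompactSupport ?_
        refine HasCompactSupport.intro (isCompact_univ_pi hS) fun g hg => ?_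
        simp only [mem_univ_pi, mem_setOf_eq, not_forall] at hg
        obtain ⟨w, hw⟩ := hg
        exact hΘχC _ _ ⟨w, hw⟩
      exact hintχ.congr (Filter.Eventually.of_forall fun g => (hΘeq _).symm)
    -- (6b) split `Π_p = Π_Z × Π_F` and Fubini (★ sum reindex), then transport to the enumerations `e₂ℕ`, `e₁`
    have hI2 := integral_pi_readers_eq_integral_integral_sumReindex_of_integrable (fun w : {w : {w : InfinitePlace L // IsComplex w} // p w} => νl w.1) eσ
      (fun (w : {w : {w : InfinitePlace L // IsComplex w} // p w}) (g : ↥(archLocal L 3 (Matrix.diagonal α) w.1)) => (((g * gprimeBlockAt L α w.1 S' (c w.1) * (g)⁻¹ : ↥(archLocal L 3 (Matrix.diagonal α) w.1)) : GL (Fin 3) ℂ) : Matrix (Fin 3) (Fin 3) ℂ)) (fun Y => Θ (c, Y)) hint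
    have heqZ : (fun a : Fin m₂ => (eσ (Sum.inl a)).1) = fun k => e₂ℕ k.val := by
      funext a; rw [heσ, Equiv.ofBijective_apply, Sum.elim_inl]
    have heqF : (fun b : Fin m₁ => (eσ (Sum.inr b)).1) = e₁ := by
      funext b; rw [heσ, Equiv.ofBijective_apply, Sum.elim_inr]
    have hVAL : ∀ (eZ eZ' : Fin m₂ → {w : InfinitePlace L // IsComplex w}) (eF eF' : Fin m₁ → {w : InfinitePlace L // IsComplex w}), eZ = eZ' → eF = eF' →
        (∫ gZ : ((a : Fin m₂) → ↥(archLocal L 3 (Matrix.diagonal α) (eZ a))), ∫ gF : ((b : Fin m₁) → ↥(archLocal L 3 (Matrix.diagonal α) (eF b))),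
          Θ (c, fun i => Sum.elim (fun a => (((gZ a * gprimeBlockAt L α (eZ a) S' (c (eZ a)) * (gZ a)⁻¹ : ↥(archLocal L 3 (Matrix.diagonal α) (eZ a))) : GL (Fin 3) ℂ) : Matrix (Fin 3) (Fin 3) ℂ)) (fun b => (((gF b * gprimeBlockAt L α (eF b) S' (c (eF b)) * (gF b)⁻¹ : ↥(archLocal L 3 (Matrix.diagonal α) (eF b))) : GL (Fin 3) ℂ) : Matrix (Fin 3) (Fin 3) ℂ)) (eσ.symm i))
          ∂(Measure.pi fun b : Fin m₁ => νl (eF b)) ∂(Measure.pi fun a : Fin m₂ => νl (eZ a))) =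
        (∫ gZ : ((a : Fin m₂) → ↥(archLocal L 3 (Matrix.diagonal α) (eZ' a))), ∫ gF : ((b : Fin m₁) → ↥(archLocal L 3 (Matrix.diagonal α) (eF' b))),
          Θ (c, fun i => Sum.elim (fun a => (((gZ a * gprimeBlockAt L α (eZ' a) S' (c (eZ' a)) * (gZ a)⁻¹ : ↥(archLocal L 3 (Matrix.diagonal α) (eZ' a))) : GL (Fin 3) ℂ) : Matrix (Fin 3) (Fin 3) ℂ)) (fun b => (((gF b * gprimeBlockAt L α (eF' b) S' (c (eF' b)) * (gF b)⁻¹ : ↥(archLocal L 3 (Matrix.diagonal α) (eF' b))) : GL (Fin 3) ℂ) : Matrix (Fin 3) (Fin 3) ℂ)) (eσ.symm i))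
          ∂(Measure.pi fun b : Fin m₁ => νl (eF' b)) ∂(Measure.pi fun a : Fin m₂ => νl (eZ' a))) := by
      rintro _ _ _ _ rfl rfl; rfl
    have hI2' : (∫ g : (∀ w : {w : {w : InfinitePlace L // IsComplex w} // p w}, ↥(archLocal L 3 (Matrix.diagonal α) w.1)), Θ (c, fun w => (((g w * gprimeBlockAt L α w.1 S' (c w.1) * (g w)⁻¹ : ↥(archLocal L 3 (Matrix.diagonal α) w.1)) : GL (Fin 3) ℂ) : Matrix (Fin 3) (Fin 3) ℂ)) ∂(Measure.pi fun w : {w : {w : InfinitePlace L // IsComplex w} // p w} => νl w.1)) =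
        ∫ gZ : ((k : Fin m₂) → ↥(archLocal L 3 (Matrix.diagonal α) (e₂ℕ k.val))), ∫ gF : ((j : Fin m₁) → ↥(archLocal L 3 (Matrix.diagonal α) (e₁ j))),
          Θ (c, fun i => Sum.elim (fun k => (((gZ k * gprimeBlockAt L α (e₂ℕ k.val) S' (c (e₂ℕ k.val)) * (gZ k)⁻¹ : ↥(archLocal L 3 (Matrix.diagonal α) (e₂ℕ k.val))) : GL (Fin 3) ℂ) : Matrix (Fin 3) (Fin 3) ℂ)) (fun j => (((gF j * gprimeBlockAt L α (e₁ j) S' (c (e₁ j)) * (gF j)⁻¹ : ↥(archLocal L 3 (Matrix.diagonal α) (e₁ j))) : GL (Fin 3) ℂ) : Matrix (Fin 3) (Fin 3) ℂ)) (eσ.symm i))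
          ∂(Measure.pi fun j : Fin m₁ => νl (e₁ j)) ∂(Measure.pi fun k : Fin m₂ => νl (e₂ℕ k.val)) :=
      hI2.trans (hVAL _ _ _ _ heqZ heqF)
    -- (6c) the face tower inside the `Z`-integral
    have hI3 : (fun gZ : ((k : Fin m₂) → ↥(archLocal L 3 (Matrix.diagonal α) (e₂ℕ k.val))) => ∫ gF : ((j : Fin m₁) → ↥(archLocal L 3 (Matrix.diagonal α) (e₁ j))),
          Θ (c, fun i => Sum.elim (fun k => (((gZ k * gprimeBlockAt L α (e₂ℕ k.val) S' (c (e₂ℕ k.val)) * (gZ k)⁻¹ : ↥(archLocal L 3 (Matrix.diagonal α) (e₂ℕ k.val))) : GL (Fin 3) ℂ) : Matrix (Fin 3) (Fin 3) ℂ)) (fun j => (((gF j * gprimeBlockAt L α (e₁ j) S' (c (e₁ j)) * (gF j)⁻¹ : ↥(archLocal L 3 (Matrix.diagonal α) (e₁ j))) : GL (Fin 3) ℂ) : Matrix (Fin 3) (Fin 3) ℂ)) (eσ.symm i))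
          ∂(Measure.pi fun j : Fin m₁ => νl (e₁ j))) =
        fun gZ => K • ∫ h : Fin m₁ → ↥(unitaryGroupOfForm (starRingEnd ℂ) J),
          fF (((c, fun k => (((gZ k * gprimeBlockAt L α (e₂ℕ k.val) S' (c (e₂ℕ k.val)) * (gZ k)⁻¹ : ↥(archLocal L 3 (Matrix.diagonal α) (e₂ℕ k.val))) : GL (Fin 3) ℂ) : Matrix (Fin 3) (Fin 3) ℂ)), fun j => c (e₁ j)), fun j => (((h j * ⟨Matrix.GeneralLinearGroup.mkOfDetNeZero !![(1 : ℂ), 1; 1, -1] det_cayleyTwo_ne_zero * circleDiagonal 2 ![Circle.exp ((c (e₁ j) 0 - c (e₁ j) 2) / 2), Circle.exp (-((c (e₁ j) 0 - c (e₁ j) 2) / 2))] * (Matrix.GeneralLinearGroup.mkOfDetNeZero !![(1 : ℂ), 1; 1, -1] det_cayleyTwo_ne_zero)⁻¹, cayley_conj_circleDiagonal_mem_of_eq_over hJ _⟩ * (h j)⁻¹ : ↥(unitaryGroupOfForm (starRingEnd ℂ) J)) : GL (Fin 2) ℂ) : Matrix (Fin 2) (Fin 2) ℂ)) ∂(Measure.pi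 fun _ : Fin m₁ => μ₀) := by
      funext gZ
      have h := hfFI (c, fun k => (((gZ k * gprimeBlockAt L α (e₂ℕ k.val) S' (c (e₂ℕ k.val)) * (gZ k)⁻¹ : ↥(archLocal L 3 (Matrix.diagonal α) (e₂ℕ k.val))) : GL (Fin 3) ℂ) : Matrix (Fin 3) (Fin 3) ℂ)) (fun j => c (e₁ j)) hcUF hregF
      rw [hΘFdef] at h
      simp only [hΘeq]
      exact h
    -- (6d) the central torus points at the scalar places; the two charts read back
    have hconj : ∀ (g : (k : Fin m₂) → ↥(archLocal L 3 (Matrix.diagonal α) (e₂ℕ k.val))) (k : Fin m₂), (((g k * gprimeBlockAt L α (e₂ℕ k.val) S' (c (e₂ℕ k.val)) * (g k)⁻¹ : ↥(archLocal L 3 (Matrix.diagonal α) (e₂ℕ k.val))) : GL (Fin 3) ℂ) : Matrix (Fin 3) (Fin 3) ℂ) = (((g k * (⟨circleDiagonal 3 (fun i => Circle.exp (x (e₂ℕ k.val) 0) * Circle.exp ((Φ₂ c - Φ₂ x) k i)), circleDiagonal_mem_archLocal_diagonal L 3 α (e₂ℕ k.val) _⟩ : ↥(archLocal L 3 (Matrix.diagonal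 α) (e₂ℕ k.val))) * (g k)⁻¹ : ↥(archLocal L 3 (Matrix.diagonal α) (e₂ℕ k.val))) : GL (Fin 3) ℂ) : Matrix (Fin 3) (Fin 3) ℂ) := by
      intro g k
      rw [conj_gprimeBlockAt_eq_conj_circleDiagonal_centre_of_scalar L α (e₂ℕ k.val) S' (he₂S k) (hxsc k) c (g k)]
      simp only [Pi.sub_apply, hΦ₂]
    have hΦ₁c : ∀ j, (c (e₁ j) 0 - c (e₁ j) 2) / 2 = Φ₁ c j := fun j => (hΦ₁ c j).symm
    have hR : (∏ k : Fin m₂, rootProduct (fun l => c (e₂ℕ k.val) ((lineOf (formSign L α (e₂ℕ k.val))).symm l) - x (e₂ℕ k.val) ((lineOf (formSign L α (e₂ℕ k.val))).symm l))) =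
        ∏ k : Fin m₂, rootProduct ((Φ₂ c - Φ₂ x) k) := by
      refine Finset.prod_congr rfl fun k _ => congrArg rootProduct (funext fun l => ?_)
      rw [Pi.sub_apply, Pi.sub_apply, hΦ₂, hΦ₂]
    have hS : (∏ j : Fin m₁, 2 * Real.sin ((c (e₁ j) 0 - c (e₁ j) 2) / 2)) = ∏ j : Fin m₁, 2 * Real.sin (Φ₁ c j) := by
      refine Finset.prod_congr rfl fun j _ => by rw [hΦ₁c]
    -- (6e) the right-hand side in iterated form
    have hRHS : ((∏ k : Fin m₂, rootProduct ((Φ₂ c - Φ₂ x) k)) • ∫ g : ((k : Fin m₂) → ↥(archLocal L 3 (Matrix.diagonal α) (e₂ℕ k.val))),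
          (fun z' : (({w : InfinitePlace L // IsComplex w} → Fin 3 → ℝ) × (Fin m₁ → ℝ)) × (Fin m₂ → Matrix (Fin 3) (Fin 3) ℂ) =>
        ((∏ k : Fin m₁, 2 * Real.sin (z'.1.2 k)) • ∫ h : Fin m₁ → ↥(unitaryGroupOfForm (starRingEnd ℂ) J),
          (fun y : (({w : InfinitePlace L // IsComplex w} → Fin 3 → ℝ) × (Fin m₂ → Matrix (Fin 3) (Fin 3) ℂ)) × (Fin m₁ → Matrix (Fin 2) (Fin 2) ℂ) => fT (y.1.1, (y.2, y.1.2)))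
            ((z'.1.1, z'.2), fun k => (((h k * ⟨Matrix.GeneralLinearGroup.mkOfDetNeZero !![(1 : ℂ), 1; 1, -1] det_cayleyTwo_ne_zero * circleDiagonal 2 ![Circle.exp (z'.1.2 k), Circle.exp (-(z'.1.2 k))] * (Matrix.GeneralLinearGroup.mkOfDetNeZero !![(1 : ℂ), 1; 1, -1] det_cayleyTwo_ne_zero)⁻¹, cayley_conj_circleDiagonal_mem_of_eq_over hJ _⟩ * (h k)⁻¹ : ↥(unitaryGroupOfForm (starRingEnd ℂ) J)) : GL (Fin 2) ℂ) : Matrix (Fin 2) (Fin 2) ℂ)) ∂(Measure.pi fun _ : Fin m₁ => μ₀)))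
            ((c, Φ₁ c), fun k => (((g k * (⟨circleDiagonal 3 (fun i => Circle.exp (x (e₂ℕ k.val) 0) * Circle.exp ((Φ₂ c - Φ₂ x) k i)), circleDiagonal_mem_archLocal_diagonal L 3 α (e₂ℕ k.val) _⟩ : ↥(archLocal L 3 (Matrix.diagonal α) (e₂ℕ k.val))) * (g k)⁻¹ : ↥(archLocal L 3 (Matrix.diagonal α) (e₂ℕ k.val))) : GL (Fin 3) ℂ) : Matrix (Fin 3) (Fin 3) ℂ))
            ∂(Measure.pi fun k : Fin m₂ => νl (e₂ℕ k.val))) =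
        (((∏ k : Fin m₂, rootProduct ((Φ₂ c - Φ₂ x) k)) : ℝ) : ℂ) * ((((∏ j : Fin m₁, 2 * Real.sin (Φ₁ c j)) : ℝ) : ℂ) *
          ∫ g : ((k : Fin m₂) → ↥(archLocal L 3 (Matrix.diagonal α) (e₂ℕ k.val))), ∫ h : Fin m₁ → ↥(unitaryGroupOfForm (starRingEnd ℂ) J),
            fF (((c, fun k => (((g k * (⟨circleDiagonal 3 (fun i => Circle.exp (x (e₂ℕ k.val) 0) * Circle.exp ((Φ₂ c - Φ₂ x) k i)), circleDiagonal_mem_archLocal_diagonal L 3 α (e₂ℕ k.val) _⟩ : ↥(archLocal L 3 (Matrix.diagonal α) (e₂ℕ k.val))) * (g k)⁻¹ : ↥(archLocal L 3 (Matrix.diagonal α) (e₂ℕ k.val))) : GL (Fin 3) ℂ) : Matrix (Fin 3) (Fin 3) ℂ)), fun j => c (e₁ j)), fun j => (((h j * ⟨Matrix.GeneralLinearGroup.mkOfDetNeZero !![(1 : ℂ), 1; 1, -1] det_cayleyTwo_ne_zero * circleDiagonal 2 ![Circle.exp (Φ₁ c j), Circle.exp (-(Φ₁ c j))] * (Matrix.GeneralLinearGroup.mkOfDetNeZero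 !![(1 : ℂ), 1; 1, -1] det_cayleyTwo_ne_zero)⁻¹, cayley_conj_circleDiagonal_mem_of_eq_over hJ _⟩ * (h j)⁻¹ : ↥(unitaryGroupOfForm (starRingEnd ℂ) J)) : GL (Fin 2) ℂ) : Matrix (Fin 2) (Fin 2) ℂ)) ∂(Measure.pi fun _ : Fin m₁ => μ₀) ∂(Measure.pi fun k : Fin m₂ => νl (e₂ℕ k.val))) := by
      simp only [hfTdef]
      rw [integral_smul, Complex.real_smul, Complex.real_smul]
    -- (6f) the two iterated forms agree (central torus points, face angles)
    have hMID : (∫ g : ((k : Fin m₂) → ↥(archLocal L 3 (Matrix.diagonal α) (e₂ℕ k.val))), ∫ h : Fin m₁ → ↥(unitaryGroupOfForm (starRingEnd ℂ) J),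
          fF (((c, fun k => (((g k * gprimeBlockAt L α (e₂ℕ k.val) S' (c (e₂ℕ k.val)) * (g k)⁻¹ : ↥(archLocal L 3 (Matrix.diagonal α) (e₂ℕ k.val))) : GL (Fin 3) ℂ) : Matrix (Fin 3) (Fin 3) ℂ)), fun j => c (e₁ j)), fun j => (((h j * ⟨Matrix.GeneralLinearGroup.mkOfDetNeZero !![(1 : ℂ), 1; 1, -1] det_cayleyTwo_ne_zero * circleDiagonal 2 ![Circle.exp ((c (e₁ j) 0 - c (e₁ j) 2) / 2), Circle.exp (-((c (e₁ j) 0 - c (e₁ j) 2) / 2))] * (Matrix.GeneralLinearGroup.mkOfDetNeZero !![(1 : ℂ), 1; 1, -1] det_cayleyTwo_ne_zero)⁻¹, cayley_conj_circleDiagonal_mem_of_eq_over hJ _⟩ * (h j)⁻¹ : ↥(unitaryGroupOfForm (starRingEnd ℂ) J)) : GL (Fin 2) ℂ) : Matrix (Fin 2) (Fin 2) ℂ)) ∂(Measure.pi fun _ : Fin m₁ => μ₀) ∂(Measure.pi fun k : Fin m₂ => νl (e₂ℕ k.val))) =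
        ∫ g : ((k : Fin m₂) → ↥(archLocal L 3 (Matrix.diagonal α) (e₂ℕ k.val))), ∫ h : Fin m₁ → ↥(unitaryGroupOfForm (starRingEnd ℂ) J),
            fF (((c, fun k => (((g k * (⟨circleDiagonal 3 (fun i => Circle.exp (x (e₂ℕ k.val) 0) * Circle.exp ((Φ₂ c - Φ₂ x) k i)), circleDiagonal_mem_archLocal_diagonal L 3 α (e₂ℕ k.val) _⟩ : ↥(archLocal L 3 (Matrix.diagonal α) (e₂ℕ k.val))) * (g k)⁻¹ : ↥(archLocal L 3 (Matrix.diagonal α) (e₂ℕ k.val))) : GL (Fin 3) ℂ) : Matrix (Fin 3) (Fin 3) ℂ)), fun j => c (e₁ j)), fun j => (((h j * ⟨Matrix.GeneralLinearGroup.mkOfDetNeZero !![(1 : ℂ), 1; 1, -1] det_cayleyTwo_ne_zero * circleDiagonal 2 ![Circle.exp (Φ₁ c j), Circle.exp (-(Φ₁ c j))] * (Matrix.GeneralLinearGroup.mkOfDetNeZero !![(1 : ℂ), 1; 1, -1] det_cayleyTwo_ne_zero)⁻¹, cayley_conj_circleDiagonal_mem_of_eq_over hJ _⟩ * (h j)⁻¹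 : ↥(unitaryGroupOfForm (starRingEnd ℂ) J)) : GL (Fin 2) ℂ) : Matrix (Fin 2) (Fin 2) ℂ)) ∂(Measure.pi fun _ : Fin m₁ => μ₀) ∂(Measure.pi fun k : Fin m₂ => νl (e₂ℕ k.val)) := by
      refine integral_congr_ae (Filter.Eventually.of_forall fun g => ?_)
      refine integral_congr_ae (Filter.Eventually.of_forall fun h => ?_)
      dsimp only
      have h1 : (fun k : Fin m₂ => (((g k * gprimeBlockAt L α (e₂ℕ k.val) S' (c (e₂ℕ k.val)) * (g k)⁻¹ : ↥(archLocal L 3 (Matrix.diagonal α) (e₂ℕ k.val))) : GL (Fin 3) ℂ) : Matrix (Fin 3) (Fin 3) ℂ)) = fun k => (((g k * (⟨circleDiagonal 3 (fun i => Circle.exp (x (e₂ℕ k.val) 0) * Circle.exp ((Φ₂ c - Φ₂ x) k i)), circleDiagonal_mem_archLocal_diagonal L 3 α (e₂ℕ k.val) _⟩ : ↥(archLocal L 3 (Matrix.diagonal α) (e₂ℕ k.val))) * (g k)⁻¹ : ↥(archLocal L 3 (Matrix.diagonal α) (e₂ℕ k.val))) : GL (Fin 3) ℂ) : Matrix (Fin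 3) (Fin 3) ℂ) := funext fun k => hconj g k
      have h2 : (fun j : Fin m₁ => (((h j * ⟨Matrix.GeneralLinearGroup.mkOfDetNeZero !![(1 : ℂ), 1; 1, -1] det_cayleyTwo_ne_zero * circleDiagonal 2 ![Circle.exp ((c (e₁ j) 0 - c (e₁ j) 2) / 2), Circle.exp (-((c (e₁ j) 0 - c (e₁ j) 2) / 2))] * (Matrix.GeneralLinearGroup.mkOfDetNeZero !![(1 : ℂ), 1; 1, -1] det_cayleyTwo_ne_zero)⁻¹, cayley_conj_circleDiagonal_mem_of_eq_over hJ _⟩ * (h j)⁻¹ : ↥(unitaryGroupOfForm (starRingEnd ℂ) J)) : GL (Fin 2) ℂ) : Matrix (Fin 2) (Fin 2) ℂ)) = fun j => (((h j * ⟨Matrix.GeneralLinearGroup.mkOfDetNeZero !![(1 : ℂ), 1; 1, -1] det_cayleyTwo_ne_zero * circleDiagonal 2 ![Circle.exp (Φ₁ c j), Circle.exp (-(Φ₁ c j))] * (Matrix.GeneralLinearGroup.mkOfDetNeZero !![(1 : ℂ), 1; 1, -1] det_cayleyTwo_ne_zero)⁻¹, cayley_conj_circleDiagonal_mem_of_eq_over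 hJ _⟩ * (h j)⁻¹ : ↥(unitaryGroupOfForm (starRingEnd ℂ) J)) : GL (Fin 2) ℂ) : Matrix (Fin 2) (Fin 2) ℂ) := by
        funext j; simp only [hΦ₁c]
      rw [h1, h2]
    -- (6g) assemble: PKG-T identity, split, descend, dress
    have hfc := hfacT c ⟨hcU₀, hcreg⟩
    rw [hI2', hI3, integral_smul, Complex.real_smul, hMID] at hfc
    rw [hRHS, orbFamGExt_of_mem_regG L α ν' a' S' hcreg, hfc, hvfac c, hR, hS]
    ring
  -- STEP 7: the junction ★ `…_of_mixedModel`
  have hΦ₁x : Φ₁ x = 0 := by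
    funext j; rw [hΦ₁, (hface j).1, sub_self, zero_div]; rfl
  have hΦ₁ne : ∀ c ∈ U' ∩ RegG S', ∀ j : Fin m₁, Φ₁ c j ≠ 0 := fun c hc j => by
    rw [hΦ₁]; exact half_sub_ne_zero_of_mem_regG S' (he₁S j) hc.2
  have hΦ₂inj : ∀ c ∈ U' ∩ RegG S', ∀ k : Fin m₂, Injective (Φ₂ c k - Φ₂ x k) := fun c hc k => by
    have h := injective_sub_relabel_of_mem_regG S' (he₂S k) (hxsc k) (lineOf (formSign L α (e₂ℕ k.val))) hc.2
    refine fun l l' hll' => h ?_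
    simpa only [Pi.sub_apply, hΦ₂] using hll'
  have hfT : ContDiffOn ℝ ∞ fT ((univ : Set ({w : InfinitePlace L // IsComplex w} → Fin 3 → ℝ)) ×ˢ univ) := by
    rw [hfTdef]
    refine ContDiff.contDiffOn (hfF.comp ?_)
    exact ((contDiff_fst.prodMk (contDiff_snd.comp contDiff_snd)).prodMk
      ((contDiff_pi.2 fun j => (contDiff_apply ℝ (Fin 3 → ℝ) (e₁ j)).comp contDiff_fst))).prodMk (contDiff_fst.comp contDiff_snd)
  have hfTC₁ : ∀ (q : {w : InfinitePlace L // IsComplex w} → Fin 3 → ℝ) (X : (Fin m₁ → Matrix (Fin 2) (Fin 2) ℂ) × (Fin m₂ → Matrix (Fin 3) (Fin 3) ℂ)),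
      (∃ k, X.1 k ∉ C') → fT (q, X) = 0 := fun q X hX => by
    rw [hfTdef]; exact hfFC _ _ hX
  have hfTC₂ : ∀ (q : {w : InfinitePlace L // IsComplex w} → Fin 3 → ℝ) (X : (Fin m₁ → Matrix (Fin 2) (Fin 2) ℂ) × (Fin m₂ → Matrix (Fin 3) (Fin 3) ℂ)),
      (∃ k, X.2 k ∉ C) → fT (q, X) = 0 := fun q X hX => by
    rw [hfTdef]
    exact hfFZ (q, X.2) (fun X₁ => hΘFC₂ q X.2 X₁ hX) _ _
  have hu : ContDiffOn ℝ ∞ uu U' := by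
    rw [huudef]; exact ((hv.contDiffOn.mul (hu₀.mono fun c hc => hc.1.2)).mul contDiffOn_const)
  have hAQ : MapsTo A U' (univ : Set ({w : InfinitePlace L // IsComplex w} → Fin 3 → ℝ)) := mapsTo_univ _ _
  have h1 : ContDiffOn ℝ ∞ (orbFamGExt L α ν' a' S') (InRegG (slotSign L α) S') := contDiffOn_orbFamGExt_inRegG L α ν' S' hα hreal hS' ha'
  exact exists_nhds_bddAbove_norm_iteratedFDeriv_orbFamGExt_of_mixedModel L α ν' a' S' hα hreal hJ μ₀ νl ζ e₂ℕ m₁ m₂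
    A hU'n isOpen_univ hAQ Φ₁ hΦ₁x hΦ₁ne Φ₂ hΦ₂inj fT hfT hC' hfTC₁ hC hfTC₂ uu hu hmodel h1 n

/-! ## EDITION 2 — HYPOTHESIS-FREE: the organ O-L1d′-N over ★ (M2) `exists_descent_box_localOrbitalIntegral_param` ∘ ★ (S-ad) `exists_desc_of_localDescent` -/

/-- **`hα`-TWIN (N8 census CUT B) of ★ `exists_nhds_bddAbove_norm_iteratedFDeriv_orbFamGExt_of_mixedCorner_normalised`** — (I₁) AT (0,2)-NORMALISED MIXED CORNERS, hypothesis-free,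
for ANY non-degenerate real diagonal frame (`hherm`, `hα`); statement and body otherwise VERBATIM. [cite: Varadarajan1977, Part I §1.12, §3] [cite: Bouaziz1994IntegralesOrbitales, §3.1 (I₁)–(I₂) p. 579; §3.2 p. 580] [cite: Shelstad1979, §4 pp. 22–25] [cite: Rogawski1990, §4.12 Lemma 4.12.1; §8.2 pp. 118–124] [cite: WarnerHASSLG2, Thm. 8.4.3.1] [cite: HormanderALPDO1, §1.1 Thms. 1.1.8, 1.1.9] -/
theorem exists_nhds_bddAbove_norm_iteratedFDeriv_orbFamGExt_of_mixedCorner_normalised_of_ne_zero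
    (hherm : ((Matrix.diagonal α).map (cmConjRingHom L)).transpose = Matrix.diagonal α)
    (hα : ∀ i, α i ≠ 0)
    (a' : ↥(arch (↥(maximalRealSubfield L)) L (IsCMField.complexConj L) 3 (Matrix.diagonal α)) → ℂ) (ha' : ArchSmooth L 3 (Matrix.diagonal α) a') :
    ∀ (S' : Finset {w : InfinitePlace L // IsComplex w}), (∀ w, w ∈ S' → w ∈ splitChartPlaces L α) →
      ∀ (n : ℕ) (x : {w : InfinitePlace L // IsComplex w} → Fin 3 → ℝ),
      (∀ w' : {w : InfinitePlace L // IsComplex w}, w' ∉ S' → ∀ l : Fin 3, x w' l ∈ Ico 0 (2 * Real.pi)) →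
      (∃ w : {w : InfinitePlace L // IsComplex w}, w ∉ S' ∧ (∃ i j : Fin 3, i ≠ j ∧ slotSign L α w i ≠ slotSign L α w j) ∧
        (∀ l l' : Fin 3, Circle.exp (x w l) = Circle.exp (x w l')) ∧
        ∃ w', w' ∉ S' ∧ w' ≠ w ∧ ∃ i' j' : Fin 3, i' ≠ j' ∧ slotSign L α w' i' ≠ slotSign L α w' j' ∧ Circle.exp (x w' i') = Circle.exp (x w' j')) →
      (∀ w' : {w : InfinitePlace L // IsComplex w}, w' ∉ S' → slotSign L α w' 1 ≠ slotSign L α w' 2 →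
        Circle.exp (x w' 1) = Circle.exp (x w' 2) → Circle.exp (x w' 0) = Circle.exp (x w' 1)) →
      ∃ U ∈ 𝓝 x, BddAbove ((fun c => ‖iteratedFDeriv ℝ n (orbFamGExt L α ν' a' S') c‖) '' (U ∩ InRegG (slotSign L α) S')) := by
  have hreal : ∀ (w' : {w : InfinitePlace L // IsComplex w}) (i : Fin 3), (w'.1.embedding (α i)).im = 0 :=
    im_embedding_diagonal_eq_zero L 3 α (complexConj_apply_eq_of_diagonal_frame hherm)
  refine exists_nhds_bddAbove_norm_iteratedFDeriv_orbFamGExt_of_mixedCorner_normalised_of_desc_of_ne_zero L α ν' hherm hα a' ha' ?_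
  intro J hJ _ _ _ _ μ₀ _ _ S' hS' w hw hwsp pw h02 h01 _ _ νw _ _ P _ _ _ Θ hΘ C hC hΘC
  obtain ⟨K, U, f, C', -, hU, hpw, hf, hC', hfC', hZ, -, hI⟩ :=
    exists_descent_box_localOrbitalIntegral_param L α hα hreal hJ μ₀ hS' hw hwsp h02 h01 νw Θ hΘ ⟨C, hC, hΘC⟩
  exact exists_desc_of_localDescent hJ μ₀ L α S' w νw Θ (K : ℂ) hU hpw hf hC' hfC' hZ
    (fun ξ cw hcw hinj => by rw [← Complex.real_smul]; exact hI ξ cw hcw hinj)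

/-- **`hα`-TWIN (N8 census CUT B) of ★ `centralMixedJetBounds_of_normalised` — THE `hCm` SOCKET FROM ITS `(0,2)`-NORMALISED FORM in the non-degenerate frame
`(hherm, hα)`** (= ★ `mixedJetBounds_of_normalised` after `hreal`); hypothesis-free socket: feed `hN := …_of_mixedCorner_normalised_of_ne_zero L α ν' hherm hα a' ha'`.
[cite: Shelstad1979, §4 property (II) p. 23; Lemma 4.3 (p. 25)] [cite: Varadarajan1977, Part I §1.12] [cite: Bouaziz1994IntegralesOrbitales, §3.1 (I₁)–(I₂) p. 579; §3.2 p. 580] -/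
theorem centralMixedJetBounds_of_normalised_of_ne_zero
    (hherm : ((Matrix.diagonal α).map (cmConjRingHom L)).transpose = Matrix.diagonal α) (hα : ∀ i, α i ≠ 0)
    {a' : ↥(arch (↥(maximalRealSubfield L)) L (IsCMField.complexConj L) 3 (Matrix.diagonal α)) → ℂ} (ha' : ArchSmooth L 3 (Matrix.diagonal α) a')
    (hN : ∀ (S' : Finset {w : InfinitePlace L // IsComplex w}), (∀ w, w ∈ S' → w ∈ splitChartPlaces L α) →
      ∀ (n : ℕ) (x : {w : InfinitePlace L // IsComplex w} → Fin 3 → ℝ),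
      (∀ w' : {w : InfinitePlace L // IsComplex w}, w' ∉ S' → ∀ l : Fin 3, x w' l ∈ Ico 0 (2 * Real.pi)) →
      (∃ w : {w : InfinitePlace L // IsComplex w}, w ∉ S' ∧ (∃ i j : Fin 3, i ≠ j ∧ slotSign L α w i ≠ slotSign L α w j) ∧
        (∀ l l' : Fin 3, Circle.exp (x w l) = Circle.exp (x w l')) ∧
        ∃ w', w' ∉ S' ∧ w' ≠ w ∧ ∃ i' j' : Fin 3, i' ≠ j' ∧ slotSign L α w' i' ≠ slotSign L α w' j' ∧ Circle.exp (x w' i') = Circle.exp (x w' j')) →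
      (∀ w' : {w : InfinitePlace L // IsComplex w}, w' ∉ S' → slotSign L α w' 1 ≠ slotSign L α w' 2 →
        Circle.exp (x w' 1) = Circle.exp (x w' 2) → Circle.exp (x w' 0) = Circle.exp (x w' 1)) →
      ∃ U ∈ 𝓝 x, BddAbove ((fun c => ‖iteratedFDeriv ℝ n (orbFamGExt L α ν' a' S') c‖) '' (U ∩ InRegG (slotSign L α) S'))) :
    ∀ (S' : Finset {w : InfinitePlace L // IsComplex w}) (n : ℕ) (x : {w : InfinitePlace L // IsComplex w} → Fin 3 → ℝ),
      (∀ w' : {w : InfinitePlace L // IsComplex w}, w' ∉ S' → ∀ l : Fin 3, x w' l ∈ Ico 0 (2 * Real.pi)) →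
      (∃ w : {w : InfinitePlace L // IsComplex w}, w ∉ S' ∧ (∃ i j : Fin 3, i ≠ j ∧ slotSign L α w i ≠ slotSign L α w j) ∧
        (∀ l l' : Fin 3, Circle.exp (x w l) = Circle.exp (x w l')) ∧
        ∃ w', w' ∉ S' ∧ w' ≠ w ∧ ∃ i' j' : Fin 3, i' ≠ j' ∧ slotSign L α w' i' ≠ slotSign L α w' j' ∧ Circle.exp (x w' i') = Circle.exp (x w' j')) →
      ∃ U ∈ 𝓝 x, BddAbove ((fun c => ‖iteratedFDeriv ℝ n (orbFamGExt L α ν' a' S') c‖) '' (U ∩ InRegG (slotSign L α) S')) := by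
  have hreal : ∀ (w' : {w : InfinitePlace L // IsComplex w}) (i : Fin 3), (w'.1.embedding (α i)).im = 0 :=
    im_embedding_diagonal_eq_zero L 3 α (complexConj_apply_eq_of_diagonal_frame hherm)
  exact mixedJetBounds_of_normalised L α ν' hα hreal ha' hN

end MixedNondeg

end Literature.NumberTheory.Rogawski1990

end
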